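import Summits.ABC.ABC.Theses.IsogenyGlueCongruence
import Summits.ABC.ABC.Theorems.IsogenyGlueCongruenceSharpDegreeOfPolyDegreeValuation
import Summits.ABC.ABC.Theorems.IsogenyGlueCongruenceSharpDegreeOfPolyDegreeOptimalComparison
import Summits.ABC.ABC.Theorems.IsogenyGlueCongruenceSharpDegreeOfPolyDegreeTakahashiBound
import Summits.ABC.ABC.Theorems.IsogenyGlueCongruenceSharpDegreeOfPolyDegreeXiSharpOfSharp
import Summits.ABC.ABC.Theorems.IsogenyGlueCongruenceSharpDegreeOfPolyDegreeRelocation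
import Literature.NumberTheory.EllipticCurves.TakahashiDegreeFormula
import Literature.NumberTheory.EllipticCurves.PastenSpectralDegree
import Literature.NumberTheory.EllipticCurves.ModularDegreeMinimal
import Literature.NumberTheory.Automorphic.BrandtXi
import Literature.NumberTheory.DiophantineGeometry.PastenValuationProductsProofs
import Literature.NumberTheory.DiophantineGeometry.MinimalDiscriminantNormProofs

set_option linter.dupNamespace false

/-!
# Skeleton — crux stmt-ABC-10895 (`SharpDegreeOfPolyDegree`, R = Poly → X), line `Sketch`

Lead's registered skeleton (lead -0 2026-08-16T08:26Z; reshaped by lead -1, cycle 2), from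
`Cruxes/SharpDegreeOfPolyDegree/SketchIdeator3.lean` (card `Ideas/oldforms-free-under-poly.md`).
`R := SharpDegreeOfPolyDegree = (Poly → SemistableDegreeConjecture)`, `Poly` = the polynomial
modular-degree bound for semistable curves (inlined verbatim in every stub that uses it).

Stubs (all signatures INLINED — no local definitions — so that each can be proved verbatim in a
`Summits/ABC/ABC/Theorems/…` file and landed `--supports stmt-ABC-10895`):

OPEN
* `stub_xiSharpUnderPoly` (C⁺, the residual, held by the lead): Poly → ξ(E; N/q, q) ≤ C_ε N^{2+ε}
  for semistable `E`, `q` an odd prime of `N`.  abc-strength; certified ⟺ R modulo the two leaves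
  (`stub_xiSharpIffSharp`, landed p96082).
* `stub_mazurKenkuBound : MazurKenkuBound` — the route ITEM stmt-ABC-15125 (rank 9, KNOWN in print,
  XL formal debt), whose body is the Literature fact `PastenShimura2024_minimalDegree_le_163_mul`
  verbatim (definitionally equal: it is fed to `stub_optimalComparison` as is).  Cycle-2 reshape of
  lead -0's `stub_pasten163` so that the leaf IS the existing item.  BLOCKED on that item.
* `stub_takahashi : takahashi2001_thm_2_3` — Literature named fact (Takahashi 2001 Thm 2.3 + 3.8),
  XL formal debt, no item.  BLOCKED on the fact.

CLOSED (landed `--supports stmt-ABC-10895`, namespace `Summit.ABC.ABC.Theorems.SharpDegreeOfPolyDegree`)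
* `stub_valuationLogBound` (L0, p86191): Poly → `v_p(Δ_min E) · log p ≤ A log N_E + A`.
* `stub_optimalComparison` (OC, p87602): `Pasten163 →` `deg_min(W) ≤ 163 · deg D₀`, `D₀` optimal of a
  semistable `W₀` with the same conductor and `a`-sequence.
* `stub_takahashiBound` (TB, p91149): `takahashi2001_thm_2_3 →` `deg D₀ ≤ ξ(L/q, q) · v_q(Δ_min W₀)`.
* `stub_xiSharpOfSharp` (converse certificate, p91994): `takahashi2001_thm_2_3 → R → C⁺`.
* `stub_xiSharpIffSharp` (relocation theorem, p96082): `takahashi2001_thm_2_3 → Pasten163 → (C⁺ ↔ R)`.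
* `stub_xiFloor` (ξ-side exponent floor, p96413): facts → ∀ θ < 3/2, (C⁺ with exponent θ) ↔ ¬Poly —
  the `2` of C⁺ is optimal (below `2` modulo `PeterssonLowerBound` in the same file).
* `stub_ofTarget` (logical position, p96259): `X → R` — the crux closes the day the target lands.
(The last two are not restated below — their modules post-date the farm snapshot this skeleton is
checked against; they are tree theorems `Summit.ABC.ABC.Theorems.SharpDegreeOfPolyDegree.stub_xiFloor`
/ `.stub_ofTarget`.)

Composition `SharpDegreeOfPolyDegree_of` (PROVED modulo the three open stubs; concludes the crux
decl by name): the landed conditional composition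
`Summit.ABC.ABC.Theorems.SharpDegreeOfPolyDegree.sharpDegreeOfPolyDegree_of_xiSharpUnderPoly`
(= lead -0's in-file composition, now a tree theorem: for an odd prime `q ∣ N`,
`deg_min(W) ≤ 163 · deg D₀ ≤ 163 · ξ(W; N/q, q) · v_q(Δ_min W₀) ≤ 163 · C N^{2+ε/2} · max(A,0)(2/ε+1) N^{ε/2}`;
for `N ∈ {1, 2}` the Poly datum itself) applied to the three open stubs.
-/

noncomputable section

namespace Summit.ABC.ABC.Cruxes.SharpDegreeOfPolyDegree.Sketch

open Summit.ABC.ABC.Theses.IsogenyGlueCongruence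
open Literature.NumberTheory.EllipticCurves Literature.NumberTheory.EllipticCurves.ModularForms
open Literature.NumberTheory.DiophantineGeometry Literature.NumberTheory.Automorphic
open WeierstrassCurve

/-! ## Open stubs -/

/-- STUB (C⁺, the residual; held by the lead): the sharp definite congruence number under Poly.
abc-strength; equivalent to `R` modulo the two leaves (`stub_xiSharpIffSharp`). -/
theorem stub_xiSharpUnderPoly :
    (∃ κ C : ℝ, ∀ (W : WeierstrassCurve ℚ) [W.IsElliptic] [W.IsGloballyMinimal]
      [NeZero (W.conductorNorm ℤ)], W.IsSemistable ℤ →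
        ∃ D : ModularParametrizationData W (W.conductorNorm ℤ),
          (D.modularDegree : ℝ) ≤ C * (W.conductorNorm ℤ : ℝ) ^ κ) →
    ∀ ε : ℝ, 0 < ε → ∃ C : ℝ, ∀ (W : WeierstrassCurve ℚ) [W.IsElliptic] [W.IsGloballyMinimal]
      [NeZero (W.conductorNorm ℤ)], W.IsSemistable ℤ → ∀ q : ℕ, q.Prime → q ≠ 2 →
        q ∣ W.conductorNorm ℤ →
          (brandtXi (W.conductorNorm ℤ / q) q (fun n => W.LFunction n) : ℝ) ≤
            C * (W.conductorNorm ℤ : ℝ) ^ (2 + ε) := by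
  sorry

/-- STUB (leaf = route item stmt-ABC-15125 `MazurKenkuBound`, definitionally the Literature fact
`PastenShimura2024_minimalDegree_le_163_mul`: Pasten 2024 §3 p. 13 via Mazur 1978 Thm 1 + Kenku 1982
+ Néron integrality): the minimal parametrisation degree within an isogeny class is at most
`163 · δ_{1,N}`.  BLOCKED on the item. -/
theorem stub_mazurKenkuBound : MazurKenkuBound := by
  sorry

/-- STUB (leaf = Literature named fact): Takahashi 2001 Thm. 2.3 (`δ · i = h_r · j`,
`i · j = ord_r Δ_min`, `h_r = ξ(N/r; r)`).  BLOCKED on the fact. -/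
theorem stub_takahashi : takahashi2001_thm_2_3 := by
  sorry

/-! ## Closed stubs (landed) -/

/-- STUB (L0) — CLOSED (p86191, `Theorems/IsogenyGlueCongruenceSharpDegreeOfPolyDegreeValuation.lean`):
single-valuation bound under Poly for every semistable elliptic curve over `ℚ`. -/
theorem stub_valuationLogBound :
    (∃ κ C : ℝ, ∀ (W : WeierstrassCurve ℚ) [W.IsElliptic] [W.IsGloballyMinimal]
      [NeZero (W.conductorNorm ℤ)], W.IsSemistable ℤ →
        ∃ D : ModularParametrizationData W (W.conductorNorm ℤ),
          (D.modularDegree : ℝ) ≤ C * (W.conductorNorm ℤ : ℝ) ^ κ) →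
    ∃ A : ℝ, ∀ (W : WeierstrassCurve ℚ) [W.IsElliptic], W.IsSemistable ℤ → ∀ p : ℕ, p.Prime →
      (((W.minimalDiscriminantNorm ℤ).factorization p : ℕ) : ℝ) * Real.log p ≤
        A * Real.log (W.conductorNorm ℤ) + A :=
  Summit.ABC.ABC.Theorems.SharpDegreeOfPolyDegree.stub_valuationLogBound

/-- STUB (OC) — CLOSED (p87602, `Theorems/IsogenyGlueCongruenceSharpDegreeOfPolyDegreeOptimalComparison.lean`):
the optimal comparison from the `163`-fact. -/
theorem stub_optimalComparison :
    PastenShimura2024_minimalDegree_le_163_mul →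
    ∀ (W : WeierstrassCurve ℚ) [W.IsElliptic] [W.IsGloballyMinimal] [NeZero (W.conductorNorm ℤ)],
      W.IsSemistable ℤ → ∀ D : ModularParametrizationData W (W.conductorNorm ℤ),
        (∀ D' : ModularParametrizationData W (W.conductorNorm ℤ),
            D.modularDegree ≤ D'.modularDegree) →
          ∃ (W₀ : WeierstrassCurve ℚ) (_ : W₀.IsElliptic)
            (D₀ : ModularParametrizationData W₀ (W.conductorNorm ℤ)),
            W₀.IsSemistable ℤ ∧ W₀.conductorNorm ℤ = W.conductorNorm ℤ ∧
              (∀ n : ℕ, W₀.LFunction n = W.LFunction n) ∧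
              (∀ (W' : WeierstrassCurve ℚ) [W'.IsElliptic]
                  (D' : ModularParametrizationData W' (W.conductorNorm ℤ)),
                  D'.f = D₀.f → D₀.modularDegree ≤ D'.modularDegree) ∧
              D.modularDegree ≤ 163 * D₀.modularDegree :=
  Summit.ABC.ABC.Theorems.SharpDegreeOfPolyDegree.stub_optimalComparison

/-- STUB (TB) — CLOSED (p91149, `Theorems/IsogenyGlueCongruenceSharpDegreeOfPolyDegreeTakahashiBound.lean`):
Takahashi's bound for an optimal datum from the named fact. -/
theorem stub_takahashiBound :
    takahashi2001_thm_2_3 →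
    ∀ (W₀ : WeierstrassCurve ℚ) [W₀.IsElliptic] (L : ℕ) [NeZero L], W₀.conductorNorm ℤ = L →
      Squarefree L → ∀ q : ℕ, q.Prime → q ∣ L →
        ∀ D₀ : ModularParametrizationData W₀ L,
          (∀ (W' : WeierstrassCurve ℚ) [W'.IsElliptic] (D' : ModularParametrizationData W' L),
              D'.f = D₀.f → D₀.modularDegree ≤ D'.modularDegree) →
            D₀.modularDegree ≤
              brandtXi (L / q) q (fun n => W₀.LFunction n) *
                (W₀.minimalDiscriminantNorm ℤ).factorization q :=
  Summit.ABC.ABC.Theorems.SharpDegreeOfPolyDegree.stub_takahashiBound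

/-- STUB (converse certificate) — CLOSED (p91994, `Theorems/IsogenyGlueCongruenceSharpDegreeOfPolyDegreeXiSharpOfSharp.lean`):
`takahashi2001_thm_2_3 → R → C⁺`. -/
theorem stub_xiSharpOfSharp :
    takahashi2001_thm_2_3 → SharpDegreeOfPolyDegree →
    (∃ κ C : ℝ, ∀ (W : WeierstrassCurve ℚ) [W.IsElliptic] [W.IsGloballyMinimal]
      [NeZero (W.conductorNorm ℤ)], W.IsSemistable ℤ →
        ∃ D : ModularParametrizationData W (W.conductorNorm ℤ),
          (D.modularDegree : ℝ) ≤ C * (W.conductorNorm ℤ : ℝ) ^ κ) →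
    ∀ ε : ℝ, 0 < ε → ∃ C : ℝ, ∀ (W : WeierstrassCurve ℚ) [W.IsElliptic] [W.IsGloballyMinimal]
      [NeZero (W.conductorNorm ℤ)], W.IsSemistable ℤ → ∀ q : ℕ, q.Prime → q ≠ 2 →
        q ∣ W.conductorNorm ℤ →
          (brandtXi (W.conductorNorm ℤ / q) q (fun n => W.LFunction n) : ℝ) ≤
            C * (W.conductorNorm ℤ : ℝ) ^ (2 + ε) :=
  Summit.ABC.ABC.Theorems.SharpDegreeOfPolyDegree.stub_xiSharpOfSharp

/-- STUB (relocation theorem) — CLOSED (p96082, `Theorems/IsogenyGlueCongruenceSharpDegreeOfPolyDegreeRelocation.lean`):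
`takahashi2001_thm_2_3 → Pasten163 → (C⁺ ↔ R)` — the residual stub is exactly the crux, modulo the
two leaves. -/
theorem stub_xiSharpIffSharp :
    takahashi2001_thm_2_3 → PastenShimura2024_minimalDegree_le_163_mul →
    (((∃ κ C : ℝ, ∀ (W : WeierstrassCurve ℚ) [W.IsElliptic] [W.IsGloballyMinimal]
      [NeZero (W.conductorNorm ℤ)], W.IsSemistable ℤ →
        ∃ D : ModularParametrizationData W (W.conductorNorm ℤ),
          (D.modularDegree : ℝ) ≤ C * (W.conductorNorm ℤ : ℝ) ^ κ) →
      ∀ ε : ℝ, 0 < ε → ∃ C : ℝ, ∀ (W : WeierstrassCurve ℚ) [W.IsElliptic] [W.IsGloballyMinimal]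
        [NeZero (W.conductorNorm ℤ)], W.IsSemistable ℤ → ∀ q : ℕ, q.Prime → q ≠ 2 →
          q ∣ W.conductorNorm ℤ →
            (brandtXi (W.conductorNorm ℤ / q) q (fun n => W.LFunction n) : ℝ) ≤
              C * (W.conductorNorm ℤ : ℝ) ^ (2 + ε)) ↔ SharpDegreeOfPolyDegree) :=
  Summit.ABC.ABC.Theorems.SharpDegreeOfPolyDegree.stub_xiSharpIffSharp

/-! ## Composition -/

/-- **The line closes the crux modulo its three open stubs**: `R` from C⁺ and the two leaves, by the
landed conditional composition `sharpDegreeOfPolyDegree_of_xiSharpUnderPoly` (the `163`-leaf enters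
as the route item `MazurKenkuBound`, definitionally the Literature fact). -/
theorem SharpDegreeOfPolyDegree_of : SharpDegreeOfPolyDegree :=
  Summit.ABC.ABC.Theorems.SharpDegreeOfPolyDegree.sharpDegreeOfPolyDegree_of_xiSharpUnderPoly
    stub_takahashi stub_mazurKenkuBound stub_xiSharpUnderPoly

end Summit.ABC.ABC.Cruxes.SharpDegreeOfPolyDegree.Sketch

end
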